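import Literature.NumberTheory.EllipticCurves.TateNormalFormComponentsSum
import HarnessLib

/-!
# The component homomorphism `E(K)/E₀(K) ≅ ℤ/nℤ` for the Tate normal form `y² + xy = x³ + απⁿ`

Topic `NumberTheory/EllipticCurves` (family `abc`, G06; also `bsd`). Pure proofs, no definitions
and no named facts. For the Tate normal form `J : y² + xy = x³ + απⁿ` (`α ∈ Rˣ`, `π` a
uniformiser, `n ≥ 1`) over a Henselian discrete valuation ring `R` with fraction field `K` — the
`R`-model of every split multiplicative minimal equation (`SplitMultiplicativeNormalForm.lean`) —
the tree proves `[J(K) : J₀(K)] = n` (`LocalIndex.index_eq_of_tateNormalForm`, Silverman,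
*ATAEC*, Cor. IV.9.2(d)) through the *shape* of a bad point (`LocalIndex.shape_of_bad`): level
`i` and branch `0` (`(πⁱu, πⁱut)`, `t ∈ 𝔪`), level `i` and branch `−1` (`t + 1 ∈ 𝔪`), or middle
(`(πʰx', πʰy')`, `n = 2h`, `y' ∈ Rˣ`). This file proves the **group structure** behind the
count: there is a homomorphism `c : J(K) →+ ℤ/nℤ` with kernel `J₀(K)` taking the values `i`,
`−i`, `h` on the three shapes (`exists_addMonoidHom_zmod_of_tateNormalForm`), i.e.
`J(K)/J₀(K)` **is cyclic of order `n`, generated by the class of a level-`1` point, and the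
class of a bad point is its level up to sign** — the labelling of the components of the Néron
`n`-gon by `v(u) mod v(q)` under Tate's parametrisation `K*/q^ℤ ≅ E_q(K)` (Silverman, *ATAEC*,
V.4, Lemmas 4.1.1–4.1.4 and Cor. IV.9.2(d): "`E(K)/E₀(K)` is a cyclic group of order
`v(Δ) = −v(j)`"), obtained here without `q`-expansions.

## Proof

Two bad points of the same shape and level are congruent modulo `J₀(K)`
(`sub_mem_of_low`, `sub_mem_of_middle` of `TateNormalFormComponentsSum.lean`), so each
shape-class is one coset, and `|J(K)/J₀(K)| = n`. Let `γ` be the class of a level-`1`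
branch-`0` point `Q₁ = (π, πz₁)`. The new computation is that **the level is additive on
suitable representatives** (`shape_two_smul_repQ_one`, `shape_repQ_add_repQ_one`, from
`shape_add_of_slope_eq` of `TateNormalFormComponentsSum.lean`, the product formula
`x₁x₂x₃ = ν² − a₆`): `2Q₁` has branch `0` and level `2` (middle if `n = 4`), and `Q_k + Q₁` has
branch `0` and level `k + 1` (middle if `n = 2k + 2`) for the representatives `Q_k = (πᵏ, πᵏz_k)`
of `LocalIndex.exists_repQ`. By induction the coset of level `k` and branch `0` is `kγ`
(`2k < n`), the middle coset is `(n/2)γ`, the branch-`−1` cosets are `−kγ`, and `nγ = 0`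
(Lagrange); hence `m ↦ mγ` is a bijection `ℤ/nℤ → J(K)/J₀(K)` (`exists_addMonoidHom_zmod_of_tateNormalForm`)
and its inverse is the homomorphism `c`.

## References

* J. H. Silverman, *Advanced Topics in the Arithmetic of Elliptic Curves*, GTM 151, Springer
  1994: Cor. IV.9.2(d) (PDF p. 340), Rem. IV.9.6 (PDF p. 355), V.4, Prop. 4.1 and
  Lemmas 4.1.1–4.1.4 (PDF pp. 402–405). [SilvermanATAEC1994]
* J. H. Silverman, *The Arithmetic of Elliptic Curves*, 2nd ed., GTM 106, Springer 2009,
  Thm. VII.6.1. [SilvermanAEC2009]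
-/

noncomputable section

open scoped Classical

open IsLocalRing

namespace Literature.NumberTheory.EllipticCurves

namespace LocalIndex

open DiophantineGeometry DiophantineGeometry.TateAlgorithm

variable {R : Type*} [CommRing R] [IsDomain R] [IsDiscreteValuationRing R]
  {K : Type*} [Field K] [Algebra R K] [IsFractionRing R K]

section TateNormalForm

variable (J : WeierstrassCurve R) {ϖ : R} {α : R} {n : ℕ}

/-! ### The two representative sums: `2Q₁` and `Q_k + Q₁` -/

omit [IsDiscreteValuationRing R] in
/-- The equation of `Q_m = (πᵐ, πᵐz)` on `y² + xy = x³ + απⁿ` (`2m ≤ n`):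
`z(z + 1) = πᵐ + απ^{n−2m}`. [folklore] -/
theorem repQ_eq (hϖ : Irreducible ϖ) (h1 : J.a₁ = 1) (h2 : J.a₂ = 0) (h3 : J.a₃ = 0)
    (h4 : J.a₄ = 0) (h6 : J.a₆ = α * ϖ ^ n) {m : ℕ} (h2m : 2 * m ≤ n) {z : R}
    (hQ : (J.baseChange K).toAffine.Nonsingular (algebraMap R K (ϖ ^ m))
      (algebraMap R K (ϖ ^ m * z))) :
    z * (z + 1) = ϖ ^ m + α * ϖ ^ (n - 2 * m) := by
  have hinj := IsFractionRing.injective R K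
  have he : J.toAffine.Equation (ϖ ^ m) (ϖ ^ m * z) :=
    (WeierstrassCurve.Affine.map_equation _ hinj _ _).mp hQ.left
  rw [WeierstrassCurve.Affine.equation_iff, h1, h2, h3, h4, h6] at he
  obtain ⟨d, hd⟩ : ∃ d, n = 2 * m + d := ⟨n - 2 * m, by omega⟩
  have hd' : n - 2 * m = d := by omega
  rw [hd] at he
  rw [hd']
  refine mul_left_cancel₀ (pow_ne_zero (2 * m) hϖ.ne_zero) ?_
  rw [pow_add, pow_mul] at he
  linear_combination he

/-- **`2Q₁` has level `2`.** For the level-`1` representative `Q₁ = (π, πz)`, `z ∈ 𝔪`, of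
`y² + xy = x³ + απⁿ` with `n ≥ 4`: the tangent has slope `λ = (3π − z)/(1 + 2z) ∈ 𝔪` and
intercept `ν = π(z − λ) = π²(2απ^{n−3} − 1)/(1 + 2z) = π²·unit`, and `x₁² = π²`; so `2Q₁` is a
low point of level `2` and branch `0` if `n > 4`, and a middle point if `n = 4`
(`shape_add_of_slope_eq`). [cite: SilvermanATAEC1994, V.4 Lemma 4.1.2 (PDF p. 403)] -/
theorem shape_two_smul_repQ_one (hϖ : Irreducible ϖ) (h1 : J.a₁ = 1) (h2 : J.a₂ = 0)
    (h3 : J.a₃ = 0) (h4 : J.a₄ = 0) (hα : IsUnit α) (h6 : J.a₆ = α * ϖ ^ n) (hn : 4 ≤ n)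
    {z : R} (hz : z ∈ maximalIdeal R)
    (hQ : (J.baseChange K).toAffine.Nonsingular (algebraMap R K (ϖ ^ 1))
      (algebraMap R K (ϖ ^ 1 * z))) :
    (2 * 2 < n → ∃ (u t : R) (h : (J.baseChange K).toAffine.Nonsingular
        (algebraMap R K (ϖ ^ 2 * u)) (algebraMap R K (ϖ ^ 2 * u * t))),
        IsUnit u ∧ t ∈ maximalIdeal R ∧
        WeierstrassCurve.Affine.Point.some _ _ hQ + WeierstrassCurve.Affine.Point.some _ _ hQ =
          WeierstrassCurve.Affine.Point.some _ _ h) ∧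
    (n = 2 * 2 → ∃ (x' y' : R) (h : (J.baseChange K).toAffine.Nonsingular
        (algebraMap R K (ϖ ^ 2 * x')) (algebraMap R K (ϖ ^ 2 * y'))),
        IsUnit y' ∧
        WeierstrassCurve.Affine.Point.some _ _ hQ + WeierstrassCurve.Affine.Point.some _ _ hQ =
          WeierstrassCurve.Affine.Point.some _ _ h) := by
  have hinj := IsFractionRing.injective R K
  have hϖ0 : ϖ ≠ 0 := hϖ.ne_zero
  have hm' : ϖ ∈ maximalIdeal R := (IsLocalRing.mem_maximalIdeal _).mpr hϖ.not_isUnit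
  set f := algebraMap R K with hf
  -- the equation of `Q₁`: `z(z + 1) = ϖ + αϖ^{n-2}`, i.e. `= ϖ (1 + α ϖ^{c+1})`, `n = c + 4`
  have hzeq := repQ_eq J hϖ h1 h2 h3 h4 h6 (m := 1) (by omega) hQ
  obtain ⟨c, hc⟩ : ∃ c, n = c + 4 := ⟨n - 4, by omega⟩
  have hc' : n - 2 * 1 = c + 2 := by omega
  rw [hc', pow_one] at hzeq
  -- the unit `d = 1 + 2z` and the slope `ℓ = (3ϖ - z)/d`
  have hd : IsUnit (1 + 2 * z) := isUnit_add_of_isUnit_of_mem isUnit_one (Ideal.mul_mem_left _ _ hz)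
  set d' : R := ↑hd.unit⁻¹ with hd'
  have hdd' : (1 + 2 * z) * d' = 1 := hd.mul_val_inv
  set ℓ : R := (3 * ϖ - z) * d' with hℓ
  have hℓm : ℓ ∈ maximalIdeal R :=
    Ideal.mul_mem_right _ _ (Ideal.sub_mem _ (Ideal.mul_mem_left _ _ hm') hz)
  -- the intercept: `ϖ z - ℓ ϖ = ϖ² w`, `w = d' (2αϖ^{c+1} - 1)`
  set w : R := d' * (2 * α * ϖ ^ (c + 1) - 1) with hw
  have hwu : IsUnit w := by
    refine (hd.unit⁻¹).isUnit.mul ?_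
    rw [sub_eq_add_neg, add_comm]
    refine isUnit_add_of_isUnit_of_mem isUnit_one.neg ?_
    rw [pow_succ]
    exact Ideal.mul_mem_left _ _ (Ideal.mul_mem_left _ _ hm')
  have hν : ϖ ^ 1 * z - ℓ * ϖ ^ 1 = ϖ ^ 2 * w := by
    rw [hw, hℓ, pow_one]
    have e1 : ϖ * z - (3 * ϖ - z) * d' * ϖ = ϖ * d' * ((1 + 2 * z) * z - (3 * ϖ - z)) := by
      linear_combination (-(ϖ * z)) * hdd'
    rw [e1]
    linear_combination ϖ * d' * (2 : R) * hzeq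
  have hx : ϖ ^ 1 * ϖ ^ 1 = ϖ ^ 2 * 1 := by ring
  -- `Q₁ ≠ -Q₁`
  have hnegY : (J.baseChange K).toAffine.negY (f (ϖ ^ 1)) (f (ϖ ^ 1 * z)) =
      f (-(ϖ ^ 1 * z) - ϖ ^ 1) := by
    rw [WeierstrassCurve.Affine.negY]
    simp only [WeierstrassCurve.baseChange, WeierstrassCurve.map_a₁, WeierstrassCurve.map_a₃, h1,
      h3, ← hf, map_one, map_zero, map_sub, map_neg]; ring
  have hyne : f (ϖ ^ 1 * z) ≠ (J.baseChange K).toAffine.negY (f (ϖ ^ 1)) (f (ϖ ^ 1 * z)) := by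
    rw [hnegY]
    intro h'
    have h0 : ϖ * (1 + 2 * z) = 0 := by linear_combination hinj h'
    exact mul_ne_zero hϖ0 hd.ne_zero h0
  have hxy : ¬(f (ϖ ^ 1) = f (ϖ ^ 1) ∧
      f (ϖ ^ 1 * z) = (J.baseChange K).toAffine.negY (f (ϖ ^ 1)) (f (ϖ ^ 1 * z))) :=
    fun h' => hyne h'.2
  -- the slope of the tangent is `ℓ`
  have hslope : (J.baseChange K).toAffine.slope (f (ϖ ^ 1)) (f (ϖ ^ 1)) (f (ϖ ^ 1 * z))
      (f (ϖ ^ 1 * z)) = f ℓ := by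
    rw [WeierstrassCurve.Affine.slope_of_Y_ne rfl hyne, hnegY]
    have hnum : 3 * f (ϖ ^ 1) ^ 2 + 2 * (J.baseChange K).toAffine.a₂ * f (ϖ ^ 1) +
        (J.baseChange K).toAffine.a₄ - (J.baseChange K).toAffine.a₁ * f (ϖ ^ 1 * z) =
          f (ϖ * (3 * ϖ - z)) := by
      simp [WeierstrassCurve.baseChange, h1, h2, h4, map_ofNat, ← hf]; ring
    have hden : f (ϖ ^ 1 * z) - f (-(ϖ ^ 1 * z) - ϖ ^ 1) = f (ϖ * (1 + 2 * z)) := by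
      rw [← map_sub]; congr 1; ring
    rw [hnum, hden, div_eq_iff ((map_ne_zero_iff _ hinj).mpr (mul_ne_zero hϖ0 hd.ne_zero)),
      ← map_mul]
    congr 1
    rw [hℓ]
    linear_combination -(ϖ * (3 * ϖ - z)) * hdd'
  exact shape_add_of_slope_eq J hϖ h1 h2 h3 h4 hα h6 (by norm_num) (by omega) hℓm hwu isUnit_one
    hν hx hQ hQ hxy hslope

/-- **`Q_k + Q₁` has level `k + 1`.** For the representatives `Q_k = (πᵏ, πᵏz')` (`k ≥ 2`) and
`Q₁ = (π, πz)` (`z, z' ∈ 𝔪`) of `y² + xy = x³ + απⁿ` with `2k + 2 ≤ n`: the chord has slope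
`λ = (π^{k−1}z' − z)/(π^{k−1} − 1) ∈ 𝔪` and intercept `ν = πᵏ(z' − λ) = πᵏ(z − z')/(π^{k−1} − 1)
= π^{k+1}·unit` (`z ∈ π·Rˣ`, `z' ∈ π²R` from `z(z+1) = π(1 + απ^{n−3})`,
`z'(z'+1) = π²(π^{k−2} + απ^{n−2k−2})`), and `x₁x₂ = π^{k+1}`; so `Q_k + Q₁` is a low point of
level `k + 1` and branch `0` if `2k + 2 < n`, and a middle point if `n = 2k + 2`.
[cite: SilvermanATAEC1994, V.4 Lemma 4.1.2 (PDF p. 403)] -/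
theorem shape_repQ_add_repQ_one (hϖ : Irreducible ϖ) (h1 : J.a₁ = 1) (h2 : J.a₂ = 0)
    (h3 : J.a₃ = 0) (h4 : J.a₄ = 0) (hα : IsUnit α) (h6 : J.a₆ = α * ϖ ^ n) {k : ℕ}
    (hk : 2 ≤ k) (hkn : 2 * k + 2 ≤ n) {z z' : R} (hz : z ∈ maximalIdeal R)
    (hz' : z' ∈ maximalIdeal R)
    (hQ : (J.baseChange K).toAffine.Nonsingular (algebraMap R K (ϖ ^ k))
      (algebraMap R K (ϖ ^ k * z')))
    (hQ₁ : (J.baseChange K).toAffine.Nonsingular (algebraMap R K (ϖ ^ 1))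
      (algebraMap R K (ϖ ^ 1 * z))) :
    (2 * (k + 1) < n → ∃ (u t : R) (h : (J.baseChange K).toAffine.Nonsingular
        (algebraMap R K (ϖ ^ (k + 1) * u)) (algebraMap R K (ϖ ^ (k + 1) * u * t))),
        IsUnit u ∧ t ∈ maximalIdeal R ∧
        WeierstrassCurve.Affine.Point.some _ _ hQ + WeierstrassCurve.Affine.Point.some _ _ hQ₁ =
          WeierstrassCurve.Affine.Point.some _ _ h) ∧
    (n = 2 * (k + 1) → ∃ (x' y' : R) (h : (J.baseChange K).toAffine.Nonsingular
        (algebraMap R K (ϖ ^ (k + 1) * x')) (algebraMap R K (ϖ ^ (k + 1) * y'))),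
        IsUnit y' ∧
        WeierstrassCurve.Affine.Point.some _ _ hQ + WeierstrassCurve.Affine.Point.some _ _ hQ₁ =
          WeierstrassCurve.Affine.Point.some _ _ h) := by
  have hinj := IsFractionRing.injective R K
  have hϖ0 : ϖ ≠ 0 := hϖ.ne_zero
  have hm' : ϖ ∈ maximalIdeal R := (IsLocalRing.mem_maximalIdeal _).mpr hϖ.not_isUnit
  set f := algebraMap R K with hf
  -- the equations: `z (z + 1) = ϖ (1 + α ϖ^{c+1})`, `n = 2k + 2 + c`, and
  -- `z' (z' + 1) = ϖ² (ϖ^{k-2} + α ϖ^c)`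
  obtain ⟨c, hc⟩ : ∃ c, n = 2 * k + 2 + c := ⟨n - 2 * k - 2, by omega⟩
  obtain ⟨k₂, hk₂⟩ : ∃ k₂, k = k₂ + 2 := ⟨k - 2, by omega⟩
  have hzeq := repQ_eq J hϖ h1 h2 h3 h4 h6 (m := 1) (by omega) hQ₁
  have hz'eq := repQ_eq J hϖ h1 h2 h3 h4 h6 (m := k) (by omega) hQ
  have hc1 : n - 2 * 1 = (2 * k₂ + c + 3) + 1 := by omega
  have hck : n - 2 * k = c + 2 := by omega
  rw [hc1, pow_one] at hzeq
  rw [hck] at hz'eq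
  -- `z = ϖ a₀`, `a₀` a unit; `z' = ϖ² b`
  have hz1 : IsUnit (z + 1) := by
    rw [add_comm]; exact isUnit_add_of_isUnit_of_mem isUnit_one hz
  have hz'1 : IsUnit (z' + 1) := by
    rw [add_comm]; exact isUnit_add_of_isUnit_of_mem isUnit_one hz'
  set a₀ : R := (1 + α * ϖ ^ (2 * k₂ + c + 3)) * ↑hz1.unit⁻¹ with ha₀
  have ha₀u : IsUnit a₀ := by
    refine IsUnit.mul ?_ (hz1.unit⁻¹).isUnit
    refine isUnit_add_of_isUnit_of_mem isUnit_one ?_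
    rw [pow_succ]
    exact Ideal.mul_mem_left _ _ (Ideal.mul_mem_left _ _ hm')
  have hza : z = ϖ * a₀ := by
    have e1 : z = z * (z + 1) * ↑hz1.unit⁻¹ := by
      rw [mul_assoc, hz1.mul_val_inv, mul_one]
    rw [e1, hzeq, ha₀]; ring
  set b : R := (ϖ ^ k₂ + α * ϖ ^ c) * ↑hz'1.unit⁻¹ with hb
  have hz'b : z' = ϖ ^ 2 * b := by
    have e1 : z' = z' * (z' + 1) * ↑hz'1.unit⁻¹ := by
      rw [mul_assoc, hz'1.mul_val_inv, mul_one]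
    rw [e1, hz'eq, hb, hk₂]; ring
  -- the unit `d = ϖ^{k-1} - 1` and the slope
  have hd : IsUnit (ϖ ^ (k₂ + 1) - 1) := by
    rw [sub_eq_add_neg, add_comm]
    refine isUnit_add_of_isUnit_of_mem isUnit_one.neg ?_
    rw [pow_succ]
    exact Ideal.mul_mem_left _ _ hm'
  set d' : R := ↑hd.unit⁻¹ with hd'
  have hdd' : (ϖ ^ (k₂ + 1) - 1) * d' = 1 := hd.mul_val_inv
  set ℓ : R := (ϖ ^ (k₂ + 1) * z' - z) * d' with hℓ
  have hℓm : ℓ ∈ maximalIdeal R :=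
    Ideal.mul_mem_right _ _ (Ideal.sub_mem _ (Ideal.mul_mem_left _ _ hz') hz)
  -- the intercept `ϖ^k z' - ℓ ϖ^k = ϖ^{k+1} w`, `w = d' (a₀ - ϖ b)`
  set w : R := d' * (a₀ - ϖ * b) with hw
  have hwu : IsUnit w := by
    refine (hd.unit⁻¹).isUnit.mul ?_
    rw [sub_eq_add_neg]
    exact isUnit_add_of_isUnit_of_mem ha₀u ((Ideal.neg_mem_iff _).mpr (Ideal.mul_mem_right _ _ hm'))
  have hν : ϖ ^ k * z' - ℓ * ϖ ^ k = ϖ ^ (k + 1) * w := by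
    rw [hw, hℓ]
    have e1 : ϖ ^ k * z' - (ϖ ^ (k₂ + 1) * z' - z) * d' * ϖ ^ k =
        ϖ ^ k * d' * ((ϖ ^ (k₂ + 1) - 1) * z' - (ϖ ^ (k₂ + 1) * z' - z)) := by
      linear_combination (-(ϖ ^ k * z')) * hdd'
    rw [e1, hza, hz'b, pow_succ]
    ring
  have hx : ϖ ^ k * ϖ ^ 1 = ϖ ^ (k + 1) * 1 := by ring
  -- `x(Q_k) ≠ x(Q₁)`
  have hne : f (ϖ ^ k) ≠ f (ϖ ^ 1) := by
    intro h'
    have h0 : ϖ * (ϖ ^ (k₂ + 1) - 1) = 0 := by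
      have := hinj h'
      rw [hk₂] at this
      linear_combination this
    exact mul_ne_zero hϖ0 hd.ne_zero h0
  have hxy : ¬(f (ϖ ^ k) = f (ϖ ^ 1) ∧
      f (ϖ ^ k * z') = (J.baseChange K).toAffine.negY (f (ϖ ^ 1)) (f (ϖ ^ 1 * z))) :=
    fun h' => hne h'.1
  -- the slope of the chord is `ℓ`
  have hslope : (J.baseChange K).toAffine.slope (f (ϖ ^ k)) (f (ϖ ^ 1)) (f (ϖ ^ k * z'))
      (f (ϖ ^ 1 * z)) = f ℓ := by
    rw [WeierstrassCurve.Affine.slope_of_X_ne hne, ← map_sub, ← map_sub,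
      div_eq_iff ((map_ne_zero_iff _ hinj).mpr (sub_ne_zero.mpr fun h' => hne (congrArg f h'))),
      ← map_mul]
    congr 1
    rw [hℓ, hk₂]
    linear_combination -(ϖ * (ϖ ^ (k₂ + 1) * z' - z)) * hdd'
  have hres := shape_add_of_slope_eq J hϖ h1 h2 h3 h4 hα h6 (m := k + 1) (by omega) (by omega)
    hℓm hwu isUnit_one hν hx hQ hQ₁ hxy hslope
  exact hres

/-! ### The component homomorphism -/

open _root_.WeierstrassCurve in
/-- **The component homomorphism of the Tate normal form** (the group structure in Silverman,
*ATAEC*, Cor. IV.9.2(d): for split multiplicative reduction "`E(K)/E₀(K)` is a cyclic group of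
order `v(Δ) = −v(j)`", with the components labelled as in V.4, Lemma 4.1.2 / Rem. IV.9.6). For
`J : y² + xy = x³ + απⁿ` (`α ∈ Rˣ`, `π` a uniformiser, `n ≥ 1`) over a Henselian discrete
valuation ring `R` with fraction field `K` there is a homomorphism `c : J(K) →+ ℤ/nℤ` whose
kernel is exactly `J₀(K)` (the points with nonsingular reduction) and whose value on a bad point
is read off from its shape (`LocalIndex.shape_of_bad`): `c = i` on the low points `(πⁱu, πⁱut)`
with `t ∈ 𝔪` (`u ∈ Rˣ`, `1 ≤ i`, `2i < n`), `c = −i` on those with `t + 1 ∈ 𝔪`, and `c = h` on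
the middle points `(πʰx', πʰy')`, `n = 2h`. (Since `[J(K) : J₀(K)] = n`,
`LocalIndex.index_eq_of_tateNormalForm`, `c` induces `J(K)/J₀(K) ≅ ℤ/nℤ`.)
[cite: SilvermanATAEC1994, Cor. IV.9.2(d) (PDF p. 340)] -/
theorem exists_addMonoidHom_zmod_of_tateNormalForm [HenselianLocalRing R] (hϖ : Irreducible ϖ)
    (h1 : J.a₁ = 1) (h2 : J.a₂ = 0) (h3 : J.a₃ = 0) (h4 : J.a₄ = 0) (hα : IsUnit α)
    (hn : 1 ≤ n) (h6 : J.a₆ = α * ϖ ^ n) :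
    ∃ c : (J.baseChange K).toAffine.Point →+ ZMod n,
      (∀ P, c P = 0 ↔ J.HasNonsingularReduction P) ∧
      (∀ (i : ℕ) (u t : R) (h : (J.baseChange K).toAffine.Nonsingular
          (algebraMap R K (ϖ ^ i * u)) (algebraMap R K (ϖ ^ i * u * t))),
        1 ≤ i → 2 * i < n → IsUnit u → t ∈ maximalIdeal R →
          c (.some _ _ h) = (i : ZMod n)) ∧
      (∀ (i : ℕ) (u t : R) (h : (J.baseChange K).toAffine.Nonsingular
          (algebraMap R K (ϖ ^ i * u)) (algebraMap R K (ϖ ^ i * u * t))),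
        1 ≤ i → 2 * i < n → IsUnit u → t + 1 ∈ maximalIdeal R →
          c (.some _ _ h) = -(i : ZMod n)) ∧
      (∀ (hh : ℕ) (x' y' : R) (h : (J.baseChange K).toAffine.Nonsingular
          (algebraMap R K (ϖ ^ hh * x')) (algebraMap R K (ϖ ^ hh * y'))),
        n = 2 * hh → c (.some _ _ h) = (hh : ZMod n)) := by
  have hinj := IsFractionRing.injective R K
  have hm' : ϖ ∈ maximalIdeal R := (IsLocalRing.mem_maximalIdeal _).mpr hϖ.not_isUnit
  have h3m : J.a₃ ∈ maximalIdeal R := h3 ▸ Ideal.zero_mem _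
  have h4m : J.a₄ ∈ maximalIdeal R := h4 ▸ Ideal.zero_mem _
  have h6m : J.a₆ ∈ maximalIdeal R :=
    h6 ▸ Ideal.mul_mem_left _ _ (Ideal.pow_mem_of_mem _ hm' n hn)
  set f := algebraMap R K with hf
  set H := J.nonsingularReductionSubgroup (integers_valuationRing_valuation R K) with hH
  have hindex : H.index = n := index_eq_of_tateNormalForm J hϖ h1 h2 h3 h4 hα hn h6
  set π : (J.baseChange K).toAffine.Point →+ (J.baseChange K).toAffine.Point ⧸ H :=
    QuotientAddGroup.mk' H with hπ
  have hker : ∀ P, π P = 0 ↔ J.HasNonsingularReduction P := fun P => by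
    rw [hπ, QuotientAddGroup.mk'_apply, QuotientAddGroup.eq_zero_iff, hH,
      WeierstrassCurve.mem_nonsingularReductionSubgroup_iff]
  have hcong : ∀ P Q, J.HasNonsingularReduction (P - Q) → π P = π Q := fun P Q h => by
    rw [hπ, QuotientAddGroup.mk'_apply, QuotientAddGroup.mk'_apply, QuotientAddGroup.eq_iff_sub_mem,
      hH, WeierstrassCurve.mem_nonsingularReductionSubgroup_iff]
    exact h
  -- normalised form of the representatives `(ϖᵐ, ϖᵐ z) = (ϖᵐ·1, ϖᵐ·1·z)`
  have toStd : ∀ (m : ℕ) (z : R)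
      (hQ : (J.baseChange K).toAffine.Nonsingular (f (ϖ ^ m)) (f (ϖ ^ m * z))),
      ∃ hQ' : (J.baseChange K).toAffine.Nonsingular (f (ϖ ^ m * 1)) (f (ϖ ^ m * 1 * z)),
        Affine.Point.some _ _ hQ = Affine.Point.some _ _ hQ' := by
    intro m z hQ
    have e1 : ϖ ^ m = ϖ ^ m * 1 := (mul_one _).symm
    have e2 : ϖ ^ m * z = ϖ ^ m * 1 * z := by rw [mul_one]
    exact ⟨by simp only [mul_one]; exact hQ, point_some_congr (congrArg f e1) (congrArg f e2)⟩
  -- the generator `γ` and the classes of the three shapes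
  have hγ : ∃ γ : (J.baseChange K).toAffine.Point ⧸ H,
      (∀ (i : ℕ), 1 ≤ i → 2 * i < n → ∀ (u t : R)
        (h : (J.baseChange K).toAffine.Nonsingular (f (ϖ ^ i * u)) (f (ϖ ^ i * u * t))),
        IsUnit u → t ∈ maximalIdeal R → π (.some _ _ h) = (i : ℤ) • γ) ∧
      (∀ (i : ℕ), 1 ≤ i → 2 * i < n → ∀ (u t : R)
        (h : (J.baseChange K).toAffine.Nonsingular (f (ϖ ^ i * u)) (f (ϖ ^ i * u * t))),
        IsUnit u → t + 1 ∈ maximalIdeal R → π (.some _ _ h) = -((i : ℤ) • γ)) ∧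
      (∀ (hh : ℕ) (x' y' : R)
        (h : (J.baseChange K).toAffine.Nonsingular (f (ϖ ^ hh * x')) (f (ϖ ^ hh * y'))),
        n = 2 * hh → π (.some _ _ h) = (hh : ℤ) • γ) := by
    -- branch `-1` from branch `0`
    have hK'_of_hK : ∀ γ : (J.baseChange K).toAffine.Point ⧸ H,
        (∀ (i : ℕ), 1 ≤ i → 2 * i < n → ∀ (u t : R)
          (h : (J.baseChange K).toAffine.Nonsingular (f (ϖ ^ i * u)) (f (ϖ ^ i * u * t))),
          IsUnit u → t ∈ maximalIdeal R → π (.some _ _ h) = (i : ℤ) • γ) →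
        (∀ (i : ℕ), 1 ≤ i → 2 * i < n → ∀ (u t : R)
          (h : (J.baseChange K).toAffine.Nonsingular (f (ϖ ^ i * u)) (f (ϖ ^ i * u * t))),
          IsUnit u → t + 1 ∈ maximalIdeal R → π (.some _ _ h) = -((i : ℤ) • γ)) := by
      intro γ hK i hi h2i u t h hu ht
      obtain ⟨h', e⟩ := neg_low_of_tateNormalForm J h1 h3 h
      have hmem : -t - 1 ∈ maximalIdeal R := by
        have := (maximalIdeal R).neg_mem ht; convert this using 1; ring
      have key := hK i hi h2i u (-t - 1) h' hu hmem
      rw [← e, map_neg, neg_eq_iff_eq_neg] at key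
      exact key
    by_cases hn3 : 3 ≤ n
    · -- `γ` = the class of `Q₁ = (ϖ, ϖ z₁)`
      obtain ⟨z₁, hz₁, hQ₁⟩ := exists_repQ (K := K) J hϖ h1 h2 h3 h4 hα h6 (m := 1) le_rfl (by omega)
      set γ := π (.some _ _ hQ₁) with hγ
      -- branch `0`, level `i`: induction on `i`
      have hK : ∀ (i : ℕ), 1 ≤ i → 2 * i < n → ∀ (u t : R)
          (h : (J.baseChange K).toAffine.Nonsingular (f (ϖ ^ i * u)) (f (ϖ ^ i * u * t))),
          IsUnit u → t ∈ maximalIdeal R → π (.some _ _ h) = (i : ℤ) • γ := by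
        intro i hi
        induction i, hi using Nat.le_induction with
        | base =>
          intro _ u t h hu ht
          obtain ⟨hQ₁', e⟩ := toStd 1 z₁ hQ₁
          have hsub := sub_mem_of_low J hϖ h1 h2 h3 h4 h6m le_rfl hu isUnit_one
            (Or.inl ⟨ht, hz₁⟩) h hQ₁'
          rw [hcong _ _ hsub, ← e, Nat.cast_one, one_zsmul]
        | succ k hk ih =>
          intro h2k u t h hu ht
          -- a branch-`0` representative of level `k + 1` with known class
          have hS : ∃ (u' t' : R) (h' : (J.baseChange K).toAffine.Nonsingular
              (f (ϖ ^ (k + 1) * u')) (f (ϖ ^ (k + 1) * u' * t'))),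
              IsUnit u' ∧ t' ∈ maximalIdeal R ∧ π (.some _ _ h') = ((k : ℤ) + 1) • γ := by
            by_cases hk1 : k = 1
            · subst hk1
              obtain ⟨u', t', h', hu', ht', hsum⟩ :=
                (shape_two_smul_repQ_one J hϖ h1 h2 h3 h4 hα h6 (by omega) hz₁ hQ₁).1 (by omega)
              refine ⟨u', t', h', hu', ht', ?_⟩
              rw [← hsum, map_add, ← hγ, add_zsmul, one_zsmul, Nat.cast_one, one_zsmul]
            · have hk2 : 2 ≤ k := by omega
              obtain ⟨z', hz', hQk⟩ :=
                exists_repQ (K := K) J hϖ h1 h2 h3 h4 hα h6 (m := k) (by omega) (by omega)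
              obtain ⟨u', t', h', hu', ht', hsum⟩ :=
                (shape_repQ_add_repQ_one J hϖ h1 h2 h3 h4 hα h6 hk2 (by omega) hz₁ hz' hQk
                  hQ₁).1 (by omega)
              have hπQk : π (.some _ _ hQk) = (k : ℤ) • γ := by
                obtain ⟨hQk', e⟩ := toStd k z' hQk
                rw [e]
                exact ih (by omega) 1 z' hQk' isUnit_one hz'
              refine ⟨u', t', h', hu', ht', ?_⟩
              rw [← hsum, map_add, hπQk, ← hγ, add_zsmul, one_zsmul]
          obtain ⟨u', t', h', hu', ht', hπS⟩ := hS
          have hsub := sub_mem_of_low J hϖ h1 h2 h3 h4 h6m (by omega) hu hu' (Or.inl ⟨ht, ht'⟩)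
            h h'
          rw [hcong _ _ hsub, hπS, Nat.cast_succ]
      refine ⟨γ, hK, hK'_of_hK γ hK, ?_⟩
      -- middle points, `n = 2 hh`
      intro hh x' y' h hnh
      have hh2 : 2 ≤ hh := by omega
      have h6' : J.a₆ = α * ϖ ^ (2 * hh) := by rw [h6, hnh]
      -- a middle representative with known class
      have hS : ∃ (x'' y'' : R) (h' : (J.baseChange K).toAffine.Nonsingular
          (f (ϖ ^ hh * x'')) (f (ϖ ^ hh * y''))), π (.some _ _ h') = (hh : ℤ) • γ := by
        by_cases hh2' : hh = 2
        · subst hh2'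
          obtain ⟨x'', y'', h', -, hsum⟩ :=
            (shape_two_smul_repQ_one J hϖ h1 h2 h3 h4 hα h6 (by omega) hz₁ hQ₁).2 (by omega)
          refine ⟨x'', y'', h', ?_⟩
          rw [← hsum, map_add, ← hγ, Nat.cast_ofNat, two_zsmul]
        · obtain ⟨k, hk⟩ : ∃ k, hh = k + 1 := ⟨hh - 1, by omega⟩
          have hk2 : 2 ≤ k := by omega
          obtain ⟨z', hz', hQk⟩ :=
            exists_repQ (K := K) J hϖ h1 h2 h3 h4 hα h6 (m := k) (by omega) (by omega)
          obtain ⟨x'', y'', h', -, hsum⟩ :=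
            (shape_repQ_add_repQ_one J hϖ h1 h2 h3 h4 hα h6 hk2 (by omega) hz₁ hz' hQk hQ₁).2
              (by omega)
          have hπQk : π (.some _ _ hQk) = (k : ℤ) • γ := by
            obtain ⟨hQk', e⟩ := toStd k z' hQk
            rw [e]
            exact hK k (by omega) (by omega) 1 z' hQk' isUnit_one hz'
          subst hk
          refine ⟨x'', y'', h', ?_⟩
          rw [← hsum, map_add, hπQk, ← hγ, Nat.cast_succ, add_zsmul, one_zsmul]
      obtain ⟨x'', y'', h', hπS⟩ := hS
      have hsub := sub_mem_of_middle J hϖ h1 h2 h3 h4 hα (by omega) h6' h h'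
      rw [hcong _ _ hsub, hπS]
    · by_cases hn2 : n = 2
      · -- `γ` = the class of a middle point
        obtain ⟨w, hW⟩ := exists_repW (K := K) J hϖ h1 h2 h3 h4 hα h6 (M := 1) le_rfl (by omega)
        have e2 : ϖ ^ 1 = ϖ ^ 1 * 1 := (mul_one _).symm
        have hW' : (J.baseChange K).toAffine.Nonsingular (f (ϖ ^ 1 * w)) (f (ϖ ^ 1 * 1)) := by
          rw [← e2]; exact hW
        refine ⟨π (.some _ _ hW'), fun i hi h2i => by omega, fun i hi h2i => by omega, ?_⟩
        intro hh x' y' h hnh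
        obtain rfl : hh = 1 := by omega
        have h6' : J.a₆ = α * ϖ ^ (2 * 1) := by rw [h6, hn2]
        have hsub := sub_mem_of_middle J hϖ h1 h2 h3 h4 hα le_rfl h6' h hW'
        rw [hcong _ _ hsub, Nat.cast_one, one_zsmul]
      · -- `n = 1`: every point is good
        have hn1 : n = 1 := by omega
        refine ⟨0, fun i hi h2i => by omega, fun i hi h2i => by omega, ?_⟩
        intro hh x' y' h hnh
        omega
  obtain ⟨γ, hK, hK', hM⟩ := hγ
  -- `n • γ = 0` (Lagrange) and the homomorphism `ℤ/n → J(K)/J₀(K)`, `m ↦ m γ`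
  have hcard : Nat.card ((J.baseChange K).toAffine.Point ⧸ H) = n := hindex
  have hnγ : (zmultiplesHom _ γ) (n : ℤ) = 0 := by
    rw [zmultiplesHom_apply, natCast_zsmul, ← hcard]
    exact card_nsmul_eq_zero'
  set φ : ZMod n →+ (J.baseChange K).toAffine.Point ⧸ H := ZMod.lift n ⟨zmultiplesHom _ γ, hnγ⟩
    with hφ
  have hφm : ∀ m : ℤ, φ (m : ZMod n) = m • γ := fun m => by
    rw [hφ, ZMod.lift_coe]; rfl
  have hsurj : Function.Surjective φ := by
    intro g
    obtain ⟨P, rfl⟩ := QuotientAddGroup.mk'_surjective H g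
    by_cases hP : J.HasNonsingularReduction P
    · exact ⟨0, by rw [map_zero]; exact ((hker P).mpr hP).symm⟩
    · obtain ⟨x, y, h, rfl, hx, -⟩ := exists_eq_some_of_not_hasNonsingularReduction J h3m h4m h6m hP
      have he : J.toAffine.Equation x y :=
        (WeierstrassCurve.Affine.map_equation _ hinj x y).mp h.left
      rcases shape_of_bad J hϖ h1 h2 h3 h4 hα h6 hx he with
        ⟨i, u, t, hi, h2i, hu, rfl, rfl, ht⟩ | ⟨hh, x', y', hnh, -, rfl, rfl⟩
      · rcases ht with ht | ht
        · exact ⟨((i : ℤ) : ZMod n), by rw [hφm]; exact (hK i hi h2i u t h hu ht).symm⟩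
        · exact ⟨((-(i : ℤ) : ℤ) : ZMod n), by
            rw [hφm, neg_zsmul]; exact (hK' i hi h2i u t h hu ht).symm⟩
      · exact ⟨((hh : ℤ) : ZMod n), by rw [hφm]; exact (hM hh x' y' h hnh).symm⟩
  haveI : NeZero n := ⟨by omega⟩
  have hbij : Function.Bijective φ :=
    hsurj.bijective_of_nat_card_le (by rw [Nat.card_zmod, hcard])
  set eqv := AddEquiv.ofBijective φ hbij with heqv
  have hc : ∀ (P) (k : ZMod n), (eqv.symm.toAddMonoidHom.comp π) P = k ↔ π P = φ k := by
    intro P k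
    rw [AddMonoidHom.coe_comp, Function.comp_apply, AddEquiv.coe_toAddMonoidHom,
      AddEquiv.symm_apply_eq, heqv, AddEquiv.ofBijective_apply]
  refine ⟨eqv.symm.toAddMonoidHom.comp π, fun P => ?_, ?_, ?_, ?_⟩
  · rw [hc, map_zero, hker]
  · intro i u t h hi h2i hu ht
    rw [hc, ← Int.cast_natCast, hφm]
    exact hK i hi h2i u t h hu ht
  · intro i u t h hi h2i hu ht
    rw [hc, ← Int.cast_natCast, ← Int.cast_neg, hφm, neg_zsmul]
    exact hK' i hi h2i u t h hu ht
  · intro hh x' y' h hnh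
    rw [hc, ← Int.cast_natCast, hφm]
    exact hM hh x' y' h hnh

end TateNormalForm

end LocalIndex

end Literature.NumberTheory.EllipticCurves

end
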